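import Summits.HodgeConjecture.HodgeConjecture.Theorems.Ring2WeilCoverageWeilGramLevel35Principal
import Summits.HodgeConjecture.HodgeConjecture.Theorems.Ring2WeilCoverageWeilGramLevel45Principal
import Summits.HodgeConjecture.HodgeConjecture.Theorems.Ring2WeilCoverageWeilTypeBalance
import Summits.HodgeConjecture.HodgeConjecture.Theorems.Ring2WeilCoverageResidueDictionaryRowsB
import Summits.HodgeConjecture.HodgeConjecture.Theorems.Ring2WeilCoverageCMTypeSignParity
import HarnessLib

/-!
# Weil-type family coverage — the `g = 12` census NO rows `(35, ℚ(√−7))`, `(35, ℚ(√−35))`, `(45, ℚ(√−3))`, `(45, ℚ(√−15))` in their OWN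
# phrasing (`N_K`-balanced CM types), re-proved through van Geemen's SIGN: a second kernel route to the THEOREM-L verdicts

research route conditional on HC_CM; not a corollary; Q11.4-sentence-2 already refuted in dim ≥ 3.

Ring 2, WEIL-TYPE FAMILY-COVERAGE CENSUS (`HOME/WEIL-FAMILY-COVERAGE.md` `## b01`, block b01.49; owner ring2-b01), part 154
of the `Ring2WeilCoverage*` series — the `g = 12` edition of part 117.  The `…Principal` files proved: no principal-type `ζ′` on
`ℤ[ζ_M]` is `Φ`-positive on a CM type of `s`-signature `(6,6)` (the principal Gram determinant has the wrong sign against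
`0 < (−1)^6 det a`, part 92).  The census phrases «Weil type for `K_d`» by the residue set: `Φ` is BALANCED for `N_K`
(`2|S_Φ ∩ N_K| = |S_Φ|`).  The residue dictionary rows of part 27b (`ResidueDictionaryRowsB.nK_…`: `Im φ(s) < 0 ↔ t ∈ N_K`)
and part 28's bridge `two_mul_card_inter_eq_card_iff` turn «`N_K`-balanced» into «`s`-signature `(6,6)`», so:

* **`not_pos_of_principal_thirtyFive_sqrt_neg_seven`** (`N_K = {3, 6, 12, 13, 17, 19, 24, 26, 27, 31, 33, 34}`, `det a = −481890304`);
* **`not_pos_of_principal_thirtyFive_sqrt_neg_thirtyFive`** (`N_K = {2, 6, 8, 18, 19, 22, 23, 24, 26, 31, 32, 34}`, `det a = −7529536000000`);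
* **`not_pos_of_principal_fortyFive_sqrt_neg_three`** (`N_K = {2, 8, 11, 14, 17, 23, 26, 29, 32, 38, 41, 44}`, `det a = −2985984`);
* **`not_pos_of_principal_fortyFive_sqrt_neg_fifteen`** (`N_K = {7, 11, 13, 14, 22, 26, 28, 29, 37, 41, 43, 44}`, `det a = −46656000000`);

— the statements of the census's NO verdicts at these rows (b01.34/b01.38: no real unit has the required signs), obtained
from the SIGN of `det H` ([vG94 Lemma 5.2 (4)]): two independent kernel routes to the same census cells.

HONEST FRAMING as parts 119–152; `HC_CM` is used nowhere.  No `def`, no named fact, no `sorry`.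

References: [cite: vanGeemen1994HodgeAV, Lemma 5.2 (2)–(4)]; [cite: Shimura1998, §14.3 Prop. 4–5, pp. 103–104];
[cite: Aoki2002CMFermatType, §1 (p. 102)] (residue sets of CM types); census b01.34, b01.38, b01.41, b01.49 (seat-derived).
-/

noncomputable section

open Polynomial NumberField Module Complex Finset
open scoped nonZeroDivisors Real

namespace Summit.HodgeConjecture.Ring2WeilCoverage.WeilGramTwelvefoldNoPrincipalRows

open Literature.AlgebraicGeometry.Motives (CMType)
open Literature.NumberTheory.ComplexMultiplication
open Summit.HodgeConjecture.Ring2WeilCoverage.WeilTypeBalance (two_mul_card_inter_eq_card_iff)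
open Summit.HodgeConjecture.Ring2WeilCoverage.ResidueDictionaryRowsB
  (nK_fortyFive_sqrt_neg_fifteen nK_fortyFive_sqrt_neg_three nK_thirtyFive_sqrt_neg_seven nK_thirtyFive_sqrt_neg_thirtyFive)
open Summit.HodgeConjecture.Ring2WeilCoverage.CMTypeSignParity (card_filter_subtype_eq_ncard im_embedding_ne_zero_of_skew)

variable {K : Type} [Field K] [NumberField K] {ζ : K}

/-- `𝐞(t) = exp(2πi t/n) ∈ ℂ` (`ZMod.toCircle`). -/
local notation3 (prettyPrint := false) "𝐞 " t:max => ((ZMod.toCircle t : Circle) : ℂ)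

open scoped Classical in
/-- **The census NO row `(35, ℚ(√−7))` via van Geemen's sign**: for every CM type `Φ` of `ℚ(ζ_35)` balanced for
`N_K = {3, 6, 12, 13, 17, 19, 24, 26, 27, 31, 33, 34}` (the census's Weil-type condition for `ℚ(√−7)`) and every skew `ζ′` of PRINCIPAL type on
`ℤ[ζ_35]`, `ζ′` is not `Φ`-positive — i.e. `ℂ^Φ/Φ(ℤ[ζ_35])` carries no principal `ι`-compatible polarisation (balanced ⟹
`s`-signature `(6,6)` by parts 27b/28 ⟹ `Summit.HodgeConjecture.Ring2WeilCoverage.WeilGramLevel35Principal.not_pos_of_principal_sqrtNegSeven`, `det a = −481890304`, the wrong sign).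
research route conditional on HC_CM; not a corollary; Q11.4-sentence-2 already refuted in dim ≥ 3. [cite: vanGeemen1994HodgeAV, Lemma 5.2 (4)] [cite: Shimura1998, §14.3 Prop. 4–5, pp. 103–104] -/
theorem not_pos_of_principal_thirtyFive_sqrt_neg_seven [IsCyclotomicExtension {35} ℚ K] [IsCMField K]
    (hζ : IsPrimitiveRoot ζ 35) (Φ : CMType K)
    (hbal : 2 * ((Finset.univ.filter fun t : ZMod 35 => ∃ σ ∈ Φ.1, σ ζ = 𝐞 t) ∩
        ({3, 6, 12, 13, 17, 19, 24, 26, 27, 31, 33, 34} : Finset (ZMod 35))).card =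
      (Finset.univ.filter fun t : ZMod 35 => ∃ σ ∈ Φ.1, σ ζ = 𝐞 t).card)
    {ζ' : K} (hζ' : IsCMField.complexConj K ζ' = -ζ')
    (hT : CMTypeLattice.IsOfType (1 : (FractionalIdeal (𝓞 K)⁰ K)ˣ) ζ' ⊤) :
    ¬ ∀ φ : Φ.1, 0 < (φ.1 ζ').im := by
  have hs := Summit.HodgeConjecture.Ring2WeilCoverage.WeilGramLevel35.complexConj_sqrtNegSeven hζ
  have hs0 : ((1 + 2 * (ζ ^ 5 + ζ ^ 10 + ζ ^ 20)) : K) ≠ 0 := fun h => by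
    have h2 := Summit.HodgeConjecture.Ring2WeilCoverage.WeilGramLevel35.sq_sqrtNegSeven hζ
    rw [h] at h2
    norm_num at h2
  have heq := (two_mul_card_inter_eq_card_iff hζ (1 + 2 * (ζ ^ 5 + ζ ^ 10 + ζ ^ 20)) (NK := ({3, 6, 12, 13, 17, 19, 24, 26, 27, 31, 33, 34} : Finset (ZMod 35)))
    (fun φ t hφ ht => ⟨nK_thirtyFive_sqrt_neg_seven hφ ht, im_embedding_ne_zero_of_skew hs hs0 φ⟩) Φ).mp hbal
  rw [← card_filter_subtype_eq_ncard Φ (fun ψ => (ψ (1 + 2 * (ζ ^ 5 + ζ ^ 10 + ζ ^ 20))).im < 0),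
    ← card_filter_subtype_eq_ncard Φ (fun ψ => 0 < (ψ (1 + 2 * (ζ ^ 5 + ζ ^ 10 + ζ ^ 20))).im)] at heq
  have hcardΦ : Fintype.card Φ.1 = 12 := by
    have h := CMTypeLattice.two_mul_card_eq_finrank Φ
    rw [IsCyclotomicExtension.finrank K (cyclotomic.irreducible_rat (by norm_num : 0 < 35))] at h
    have htot : Nat.totient 35 = 24 := by decide
    rw [htot] at h
    omega
  have hsum := Finset.card_filter_add_card_filter_not (s := (Finset.univ : Finset Φ.1))
    (fun φ : Φ.1 => 0 < (φ.1 (1 + 2 * (ζ ^ 5 + ζ ^ 10 + ζ ^ 20))).im)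
  have hnot : (Finset.univ.filter fun φ : Φ.1 => ¬ 0 < (φ.1 (1 + 2 * (ζ ^ 5 + ζ ^ 10 + ζ ^ 20))).im) =
      Finset.univ.filter fun φ : Φ.1 => (φ.1 (1 + 2 * (ζ ^ 5 + ζ ^ 10 + ζ ^ 20))).im < 0 := by
    refine Finset.filter_congr fun φ _ => ?_
    have hne := im_embedding_ne_zero_of_skew hs hs0 φ.1
    exact ⟨fun h => lt_of_le_of_ne (not_lt.mp h) hne, fun h => not_lt.mpr h.le⟩
  rw [hnot, Finset.card_univ, hcardΦ] at hsum
  have hneg : (Finset.univ.filter fun φ : Φ.1 => (φ.1 (1 + 2 * (ζ ^ 5 + ζ ^ 10 + ζ ^ 20))).im < 0).card = 6 := by omega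
  have hposc : (Finset.univ.filter fun φ : Φ.1 => 0 < (φ.1 (1 + 2 * (ζ ^ 5 + ζ ^ 10 + ζ ^ 20))).im).card = 6 := by omega
  exact Summit.HodgeConjecture.Ring2WeilCoverage.WeilGramLevel35Principal.not_pos_of_principal_sqrtNegSeven hζ Φ hneg hposc hζ' hT

open scoped Classical in
/-- **The census NO row `(35, ℚ(√−35))` via van Geemen's sign**: for every CM type `Φ` of `ℚ(ζ_35)` balanced for
`N_K = {2, 6, 8, 18, 19, 22, 23, 24, 26, 31, 32, 34}` (the census's Weil-type condition for `ℚ(√−35)`) and every skew `ζ′` of PRINCIPAL type on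
`ℤ[ζ_35]`, `ζ′` is not `Φ`-positive — i.e. `ℂ^Φ/Φ(ℤ[ζ_35])` carries no principal `ι`-compatible polarisation (balanced ⟹
`s`-signature `(6,6)` by parts 27b/28 ⟹ `Summit.HodgeConjecture.Ring2WeilCoverage.WeilGramLevel35Principal.not_pos_of_principal_sqrtNegThirtyFive`, `det a = −7529536000000`, the wrong sign).
research route conditional on HC_CM; not a corollary; Q11.4-sentence-2 already refuted in dim ≥ 3. [cite: vanGeemen1994HodgeAV, Lemma 5.2 (4)] [cite: Shimura1998, §14.3 Prop. 4–5, pp. 103–104] -/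
theorem not_pos_of_principal_thirtyFive_sqrt_neg_thirtyFive [IsCyclotomicExtension {35} ℚ K] [IsCMField K]
    (hζ : IsPrimitiveRoot ζ 35) (Φ : CMType K)
    (hbal : 2 * ((Finset.univ.filter fun t : ZMod 35 => ∃ σ ∈ Φ.1, σ ζ = 𝐞 t) ∩
        ({2, 6, 8, 18, 19, 22, 23, 24, 26, 31, 32, 34} : Finset (ZMod 35))).card =
      (Finset.univ.filter fun t : ZMod 35 => ∃ σ ∈ Φ.1, σ ζ = 𝐞 t).card)
    {ζ' : K} (hζ' : IsCMField.complexConj K ζ' = -ζ')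
    (hT : CMTypeLattice.IsOfType (1 : (FractionalIdeal (𝓞 K)⁰ K)ˣ) ζ' ⊤) :
    ¬ ∀ φ : Φ.1, 0 < (φ.1 ζ').im := by
  have hs := Summit.HodgeConjecture.Ring2WeilCoverage.WeilGramLevel35.complexConj_sqrtNegThirtyFive hζ
  have hs0 : (((1 + 2 * (ζ ^ 5 + ζ ^ 10 + ζ ^ 20)) * (1 + 2 * (ζ ^ 7 + ζ ^ 28))) : K) ≠ 0 := fun h => by
    have h2 := Summit.HodgeConjecture.Ring2WeilCoverage.WeilGramLevel35.sq_sqrtNegThirtyFive hζ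
    rw [h] at h2
    norm_num at h2
  have heq := (two_mul_card_inter_eq_card_iff hζ ((1 + 2 * (ζ ^ 5 + ζ ^ 10 + ζ ^ 20)) * (1 + 2 * (ζ ^ 7 + ζ ^ 28))) (NK := ({2, 6, 8, 18, 19, 22, 23, 24, 26, 31, 32, 34} : Finset (ZMod 35)))
    (fun φ t hφ ht => ⟨nK_thirtyFive_sqrt_neg_thirtyFive hφ ht, im_embedding_ne_zero_of_skew hs hs0 φ⟩) Φ).mp hbal
  rw [← card_filter_subtype_eq_ncard Φ (fun ψ => (ψ ((1 + 2 * (ζ ^ 5 + ζ ^ 10 + ζ ^ 20)) * (1 + 2 * (ζ ^ 7 + ζ ^ 28)))).im < 0),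
    ← card_filter_subtype_eq_ncard Φ (fun ψ => 0 < (ψ ((1 + 2 * (ζ ^ 5 + ζ ^ 10 + ζ ^ 20)) * (1 + 2 * (ζ ^ 7 + ζ ^ 28)))).im)] at heq
  have hcardΦ : Fintype.card Φ.1 = 12 := by
    have h := CMTypeLattice.two_mul_card_eq_finrank Φ
    rw [IsCyclotomicExtension.finrank K (cyclotomic.irreducible_rat (by norm_num : 0 < 35))] at h
    have htot : Nat.totient 35 = 24 := by decide
    rw [htot] at h
    omega
  have hsum := Finset.card_filter_add_card_filter_not (s := (Finset.univ : Finset Φ.1))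
    (fun φ : Φ.1 => 0 < (φ.1 ((1 + 2 * (ζ ^ 5 + ζ ^ 10 + ζ ^ 20)) * (1 + 2 * (ζ ^ 7 + ζ ^ 28)))).im)
  have hnot : (Finset.univ.filter fun φ : Φ.1 => ¬ 0 < (φ.1 ((1 + 2 * (ζ ^ 5 + ζ ^ 10 + ζ ^ 20)) * (1 + 2 * (ζ ^ 7 + ζ ^ 28)))).im) =
      Finset.univ.filter fun φ : Φ.1 => (φ.1 ((1 + 2 * (ζ ^ 5 + ζ ^ 10 + ζ ^ 20)) * (1 + 2 * (ζ ^ 7 + ζ ^ 28)))).im < 0 := by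
    refine Finset.filter_congr fun φ _ => ?_
    have hne := im_embedding_ne_zero_of_skew hs hs0 φ.1
    exact ⟨fun h => lt_of_le_of_ne (not_lt.mp h) hne, fun h => not_lt.mpr h.le⟩
  rw [hnot, Finset.card_univ, hcardΦ] at hsum
  have hneg : (Finset.univ.filter fun φ : Φ.1 => (φ.1 ((1 + 2 * (ζ ^ 5 + ζ ^ 10 + ζ ^ 20)) * (1 + 2 * (ζ ^ 7 + ζ ^ 28)))).im < 0).card = 6 := by omega
  have hposc : (Finset.univ.filter fun φ : Φ.1 => 0 < (φ.1 ((1 + 2 * (ζ ^ 5 + ζ ^ 10 + ζ ^ 20)) * (1 + 2 * (ζ ^ 7 + ζ ^ 28)))).im).card = 6 := by omega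
  exact Summit.HodgeConjecture.Ring2WeilCoverage.WeilGramLevel35Principal.not_pos_of_principal_sqrtNegThirtyFive hζ Φ hneg hposc hζ' hT

open scoped Classical in
/-- **The census NO row `(45, ℚ(√−3))` via van Geemen's sign**: for every CM type `Φ` of `ℚ(ζ_45)` balanced for
`N_K = {2, 8, 11, 14, 17, 23, 26, 29, 32, 38, 41, 44}` (the census's Weil-type condition for `ℚ(√−3)`) and every skew `ζ′` of PRINCIPAL type on
`ℤ[ζ_45]`, `ζ′` is not `Φ`-positive — i.e. `ℂ^Φ/Φ(ℤ[ζ_45])` carries no principal `ι`-compatible polarisation (balanced ⟹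
`s`-signature `(6,6)` by parts 27b/28 ⟹ `Summit.HodgeConjecture.Ring2WeilCoverage.WeilGramLevel45Principal.not_pos_of_principal_sqrtNegThree`, `det a = −2985984`, the wrong sign).
research route conditional on HC_CM; not a corollary; Q11.4-sentence-2 already refuted in dim ≥ 3. [cite: vanGeemen1994HodgeAV, Lemma 5.2 (4)] [cite: Shimura1998, §14.3 Prop. 4–5, pp. 103–104] -/
theorem not_pos_of_principal_fortyFive_sqrt_neg_three [IsCyclotomicExtension {45} ℚ K] [IsCMField K]
    (hζ : IsPrimitiveRoot ζ 45) (Φ : CMType K)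
    (hbal : 2 * ((Finset.univ.filter fun t : ZMod 45 => ∃ σ ∈ Φ.1, σ ζ = 𝐞 t) ∩
        ({2, 8, 11, 14, 17, 23, 26, 29, 32, 38, 41, 44} : Finset (ZMod 45))).card =
      (Finset.univ.filter fun t : ZMod 45 => ∃ σ ∈ Φ.1, σ ζ = 𝐞 t).card)
    {ζ' : K} (hζ' : IsCMField.complexConj K ζ' = -ζ')
    (hT : CMTypeLattice.IsOfType (1 : (FractionalIdeal (𝓞 K)⁰ K)ˣ) ζ' ⊤) :
    ¬ ∀ φ : Φ.1, 0 < (φ.1 ζ').im := by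
  have hs := Summit.HodgeConjecture.Ring2WeilCoverage.WeilGramLevel45.complexConj_sqrtNegThree hζ
  have hs0 : ((1 + 2 * ζ ^ 15) : K) ≠ 0 := fun h => by
    have h2 := Summit.HodgeConjecture.Ring2WeilCoverage.WeilGramLevel45.sq_sqrtNegThree hζ
    rw [h] at h2
    norm_num at h2
  have heq := (two_mul_card_inter_eq_card_iff hζ (1 + 2 * ζ ^ 15) (NK := ({2, 8, 11, 14, 17, 23, 26, 29, 32, 38, 41, 44} : Finset (ZMod 45)))
    (fun φ t hφ ht => ⟨nK_fortyFive_sqrt_neg_three hφ ht, im_embedding_ne_zero_of_skew hs hs0 φ⟩) Φ).mp hbal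
  rw [← card_filter_subtype_eq_ncard Φ (fun ψ => (ψ (1 + 2 * ζ ^ 15)).im < 0),
    ← card_filter_subtype_eq_ncard Φ (fun ψ => 0 < (ψ (1 + 2 * ζ ^ 15)).im)] at heq
  have hcardΦ : Fintype.card Φ.1 = 12 := by
    have h := CMTypeLattice.two_mul_card_eq_finrank Φ
    rw [IsCyclotomicExtension.finrank K (cyclotomic.irreducible_rat (by norm_num : 0 < 45))] at h
    have htot : Nat.totient 45 = 24 := by decide
    rw [htot] at h
    omega
  have hsum := Finset.card_filter_add_card_filter_not (s := (Finset.univ : Finset Φ.1))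
    (fun φ : Φ.1 => 0 < (φ.1 (1 + 2 * ζ ^ 15)).im)
  have hnot : (Finset.univ.filter fun φ : Φ.1 => ¬ 0 < (φ.1 (1 + 2 * ζ ^ 15)).im) =
      Finset.univ.filter fun φ : Φ.1 => (φ.1 (1 + 2 * ζ ^ 15)).im < 0 := by
    refine Finset.filter_congr fun φ _ => ?_
    have hne := im_embedding_ne_zero_of_skew hs hs0 φ.1
    exact ⟨fun h => lt_of_le_of_ne (not_lt.mp h) hne, fun h => not_lt.mpr h.le⟩
  rw [hnot, Finset.card_univ, hcardΦ] at hsum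
  have hneg : (Finset.univ.filter fun φ : Φ.1 => (φ.1 (1 + 2 * ζ ^ 15)).im < 0).card = 6 := by omega
  have hposc : (Finset.univ.filter fun φ : Φ.1 => 0 < (φ.1 (1 + 2 * ζ ^ 15)).im).card = 6 := by omega
  exact Summit.HodgeConjecture.Ring2WeilCoverage.WeilGramLevel45Principal.not_pos_of_principal_sqrtNegThree hζ Φ hneg hposc hζ' hT

open scoped Classical in
/-- **The census NO row `(45, ℚ(√−15))` via van Geemen's sign**: for every CM type `Φ` of `ℚ(ζ_45)` balanced for
`N_K = {7, 11, 13, 14, 22, 26, 28, 29, 37, 41, 43, 44}` (the census's Weil-type condition for `ℚ(√−15)`) and every skew `ζ′` of PRINCIPAL type on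
`ℤ[ζ_45]`, `ζ′` is not `Φ`-positive — i.e. `ℂ^Φ/Φ(ℤ[ζ_45])` carries no principal `ι`-compatible polarisation (balanced ⟹
`s`-signature `(6,6)` by parts 27b/28 ⟹ `Summit.HodgeConjecture.Ring2WeilCoverage.WeilGramLevel45Principal.not_pos_of_principal_sqrtNegFifteen`, `det a = −46656000000`, the wrong sign).
research route conditional on HC_CM; not a corollary; Q11.4-sentence-2 already refuted in dim ≥ 3. [cite: vanGeemen1994HodgeAV, Lemma 5.2 (4)] [cite: Shimura1998, §14.3 Prop. 4–5, pp. 103–104] -/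
theorem not_pos_of_principal_fortyFive_sqrt_neg_fifteen [IsCyclotomicExtension {45} ℚ K] [IsCMField K]
    (hζ : IsPrimitiveRoot ζ 45) (Φ : CMType K)
    (hbal : 2 * ((Finset.univ.filter fun t : ZMod 45 => ∃ σ ∈ Φ.1, σ ζ = 𝐞 t) ∩
        ({7, 11, 13, 14, 22, 26, 28, 29, 37, 41, 43, 44} : Finset (ZMod 45))).card =
      (Finset.univ.filter fun t : ZMod 45 => ∃ σ ∈ Φ.1, σ ζ = 𝐞 t).card)
    {ζ' : K} (hζ' : IsCMField.complexConj K ζ' = -ζ')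
    (hT : CMTypeLattice.IsOfType (1 : (FractionalIdeal (𝓞 K)⁰ K)ˣ) ζ' ⊤) :
    ¬ ∀ φ : Φ.1, 0 < (φ.1 ζ').im := by
  have hs := Summit.HodgeConjecture.Ring2WeilCoverage.WeilGramLevel45.complexConj_sqrtNegFifteen hζ
  have hs0 : (((1 + 2 * ζ ^ 15) * (1 + 2 * (ζ ^ 9 + ζ ^ 36))) : K) ≠ 0 := fun h => by
    have h2 := Summit.HodgeConjecture.Ring2WeilCoverage.WeilGramLevel45.sq_sqrtNegFifteen hζ
    rw [h] at h2
    norm_num at h2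
  have heq := (two_mul_card_inter_eq_card_iff hζ ((1 + 2 * ζ ^ 15) * (1 + 2 * (ζ ^ 9 + ζ ^ 36))) (NK := ({7, 11, 13, 14, 22, 26, 28, 29, 37, 41, 43, 44} : Finset (ZMod 45)))
    (fun φ t hφ ht => ⟨nK_fortyFive_sqrt_neg_fifteen hφ ht, im_embedding_ne_zero_of_skew hs hs0 φ⟩) Φ).mp hbal
  rw [← card_filter_subtype_eq_ncard Φ (fun ψ => (ψ ((1 + 2 * ζ ^ 15) * (1 + 2 * (ζ ^ 9 + ζ ^ 36)))).im < 0),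
    ← card_filter_subtype_eq_ncard Φ (fun ψ => 0 < (ψ ((1 + 2 * ζ ^ 15) * (1 + 2 * (ζ ^ 9 + ζ ^ 36)))).im)] at heq
  have hcardΦ : Fintype.card Φ.1 = 12 := by
    have h := CMTypeLattice.two_mul_card_eq_finrank Φ
    rw [IsCyclotomicExtension.finrank K (cyclotomic.irreducible_rat (by norm_num : 0 < 45))] at h
    have htot : Nat.totient 45 = 24 := by decide
    rw [htot] at h
    omega
  have hsum := Finset.card_filter_add_card_filter_not (s := (Finset.univ : Finset Φ.1))
    (fun φ : Φ.1 => 0 < (φ.1 ((1 + 2 * ζ ^ 15) * (1 + 2 * (ζ ^ 9 + ζ ^ 36)))).im)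
  have hnot : (Finset.univ.filter fun φ : Φ.1 => ¬ 0 < (φ.1 ((1 + 2 * ζ ^ 15) * (1 + 2 * (ζ ^ 9 + ζ ^ 36)))).im) =
      Finset.univ.filter fun φ : Φ.1 => (φ.1 ((1 + 2 * ζ ^ 15) * (1 + 2 * (ζ ^ 9 + ζ ^ 36)))).im < 0 := by
    refine Finset.filter_congr fun φ _ => ?_
    have hne := im_embedding_ne_zero_of_skew hs hs0 φ.1
    exact ⟨fun h => lt_of_le_of_ne (not_lt.mp h) hne, fun h => not_lt.mpr h.le⟩
  rw [hnot, Finset.card_univ, hcardΦ] at hsum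
  have hneg : (Finset.univ.filter fun φ : Φ.1 => (φ.1 ((1 + 2 * ζ ^ 15) * (1 + 2 * (ζ ^ 9 + ζ ^ 36)))).im < 0).card = 6 := by omega
  have hposc : (Finset.univ.filter fun φ : Φ.1 => 0 < (φ.1 ((1 + 2 * ζ ^ 15) * (1 + 2 * (ζ ^ 9 + ζ ^ 36)))).im).card = 6 := by omega
  exact Summit.HodgeConjecture.Ring2WeilCoverage.WeilGramLevel45Principal.not_pos_of_principal_sqrtNegFifteen hζ Φ hneg hposc hζ' hT

end Summit.HodgeConjecture.Ring2WeilCoverage.WeilGramTwelvefoldNoPrincipalRows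

end
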